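import Summits.ResolutionOfSingularities.ResolutionOfSingularities.Theorems.FrobeniusLadderFRationalResolutionFreeChartOfMatrix
import HarnessLib

/-!
# Crux `FrobeniusLadder.FRationalResolution` (stmt-ResolutionOfSingularities-15317), line `redirect`,
# stub `stub_diagonalizableQuotientResolution` — THE VERTEX CHARTS (2/2) OF THE THREEFOLD CLASS `1/5(1,2,2)` (all free)

For the weight kernel `P = {m ∈ ℕ³ : 5 ∣ m₀ + 2m₁ + 2m₂} = ⟨G⟩` (`|G| = 12`), the Newton vertices are the first 5 generators and every vertex
chart is FREE (`ℕ³`, integer matrices of determinant `±5`): one lemma per vertex, each an instance of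
`…FreeChartOfMatrix.freeChart_of_matrixHom` (p844132); data found and checked by the scripts `gen/explore.py`, `gen/gen3.py` of the
session folder, re-verified here by `simp`/`omega`. Consumed by `…ClassOneFifth122`.

Honest label: combinatorial helper toward ONE leaf stub (no stub, crux or summit closed). No definitions, no named facts, no sorry.
[folklore; cite: CoxLittleSchenck2011, §1.2, §11.4]
-/

noncomputable section

-- single-problem summit: the doubled namespace component is forced
set_option linter.dupNamespace false

open CategoryTheory AlgebraicGeometry TopologicalSpace IsLocalRing
open Literature.AlgebraicGeometry.Resolution

namespace Summit.ResolutionOfSingularities.ResolutionOfSingularities.Theorems.FRationalResolution.ClassOneFifth122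

open ConeCertificateGenerators

/-- The exponent of `p ∈ ℕⁿ` in `ℤⁿ`. -/
local notation3 (prettyPrint := false) "toZ[" n "]" =>
  (Finsupp.mapRange.addMonoidHom (Nat.castAddMonoidHom ℤ) : (Fin n →₀ ℕ) →+ (Fin n →₀ ℤ))

/-- The Hilbert basis of `1/5(1,2,2)` (vertices first). -/
local notation3 (prettyPrint := false) "GG" => ({Finsupp.single 2 5, Finsupp.single 1 5, Finsupp.single 0 5, Finsupp.single 0 1 + Finsupp.single 2 2, Finsupp.single 0 1 + Finsupp.single 1 2, Finsupp.single 1 1 + Finsupp.single 2 4, Finsupp.single 1 4 + Finsupp.single 2 1, Finsupp.single 1 2 + Finsupp.single 2 3, Finsupp.single 1 3 + Finsupp.single 2 2, Finsupp.single 0 3 + Finsupp.single 2 1, Finsupp.single 0 3 + Finsupp.single 1 1, Finsupp.single 0 1 + Finsupp.single 1 1 + Finsupp.single 2 1} : Set (Fin 3 →₀ ℕ))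

set_option maxHeartbeats 400000 in
/-- **The vertex chart of `1/5(1,2,2)` at `(1, 0, 2)`**: free, basis `[[-1, 0, 3], [2, 0, -1], [0, 1, -1]]`. [folklore; cite: CoxLittleSchenck2011, §1.2] -/
theorem chart_3 (P : AddSubmonoid (Fin 3 →₀ ℕ)) (hGP : AddSubmonoid.closure GG = P) (gen : Fin 12 → ↥P)
    (hgen0 : ((gen 0 : ↥P) : Fin 3 →₀ ℕ) = (Finsupp.single 2 5 : Fin 3 →₀ ℕ))
    (_hgen1 : ((gen 1 : ↥P) : Fin 3 →₀ ℕ) = (Finsupp.single 1 5 : Fin 3 →₀ ℕ))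
    (_hgen2 : ((gen 2 : ↥P) : Fin 3 →₀ ℕ) = (Finsupp.single 0 5 : Fin 3 →₀ ℕ))
    (hgen3 : ((gen 3 : ↥P) : Fin 3 →₀ ℕ) = (Finsupp.single 0 1 + Finsupp.single 2 2 : Fin 3 →₀ ℕ))
    (_hgen4 : ((gen 4 : ↥P) : Fin 3 →₀ ℕ) = (Finsupp.single 0 1 + Finsupp.single 1 2 : Fin 3 →₀ ℕ))
    (_hgen5 : ((gen 5 : ↥P) : Fin 3 →₀ ℕ) = (Finsupp.single 1 1 + Finsupp.single 2 4 : Fin 3 →₀ ℕ))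
    (_hgen6 : ((gen 6 : ↥P) : Fin 3 →₀ ℕ) = (Finsupp.single 1 4 + Finsupp.single 2 1 : Fin 3 →₀ ℕ))
    (_hgen7 : ((gen 7 : ↥P) : Fin 3 →₀ ℕ) = (Finsupp.single 1 2 + Finsupp.single 2 3 : Fin 3 →₀ ℕ))
    (_hgen8 : ((gen 8 : ↥P) : Fin 3 →₀ ℕ) = (Finsupp.single 1 3 + Finsupp.single 2 2 : Fin 3 →₀ ℕ))
    (hgen9 : ((gen 9 : ↥P) : Fin 3 →₀ ℕ) = (Finsupp.single 0 3 + Finsupp.single 2 1 : Fin 3 →₀ ℕ))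
    (_hgen10 : ((gen 10 : ↥P) : Fin 3 →₀ ℕ) = (Finsupp.single 0 3 + Finsupp.single 1 1 : Fin 3 →₀ ℕ))
    (hgen11 : ((gen 11 : ↥P) : Fin 3 →₀ ℕ) = (Finsupp.single 0 1 + Finsupp.single 1 1 + Finsupp.single 2 1 : Fin 3 →₀ ℕ))
    (hgen0' : ∀ j, gen j ≠ 0) :
    ∃ (n' : ℕ) (Q : AddSubmonoid (Fin n' →₀ ℕ)) (ι : ↥Q →+ (Fin 3 →₀ ℤ)) (_ : Function.Injective ι)
      (_ : ∀ e : ↥P, e ≠ 0 → ∃ u : ↥Q, ι u = toZ[3] (e : Fin 3 →₀ ℕ) - toZ[3] ((gen 3 : ↥P) : Fin 3 →₀ ℕ))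
      (_ : ∀ p : ↥P, ∃ u : ↥Q, ι u = toZ[3] (p : Fin 3 →₀ ℕ))
      (_ : ∀ u : ↥Q, ∃ (p : ↥P) (r : ℕ) (e : Fin r → ↥P), (∀ i, e i ≠ 0) ∧
        ι u = toZ[3] (p : Fin 3 →₀ ℕ) + ∑ i, (toZ[3] ((e i : ↥P) : Fin 3 →₀ ℕ) - toZ[3] ((gen 3 : ↥P) : Fin 3 →₀ ℕ))),
      (∀ (κ : Type) [Field κ], IsRegularRing (AddMonoidAlgebra κ ↥Q)) ∨
      ∃ (GQ : Set (Fin n' →₀ ℕ)) (_ : GQ.Finite) (_ : (0 : Fin n' →₀ ℕ) ∉ GQ) (_ : AddSubmonoid.closure GQ = Q),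
        (∀ (κ : Type) [Field κ], ∀ u : ↥Q, (u : Fin n' →₀ ℕ) ∈ GQ →
          IsRegularRing (Localization.Away (AddMonoidAlgebra.single u (1 : κ)))) ∧
        (∀ (K : Type) [Field K], Scheme.IsRegular (affineBlowup (Ideal.span {w : ↥(Algebra.adjoin K
          ((fun d : Fin n' →₀ ℕ => MvPolynomial.monomial d (1 : K)) '' GQ)) |
          ∃ d ∈ GQ, (w : MvPolynomial (Fin n') K) = MvPolynomial.monomial d 1}))) := by
  obtain ⟨L, hLM⟩ := exists_matrixHom (n := 3) (n' := 3) ![![-1, 0, 3], ![2, 0, -1], ![0, 1, -1]]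
  have hLinj : Function.Injective L := by
    intro u u' h
    have h0 := DFunLike.congr_fun h 0
    have h1 := DFunLike.congr_fun h 1
    have h2 := DFunLike.congr_fun h 2
    simp [hLM, Fin.sum_univ_three] at h0 h1 h2
    have e0 : u 0 = u' 0 := by omega
    have e1 : u 1 = u' 1 := by omega
    have e2 : u 2 = u' 2 := by omega
    ext kk
    fin_cases kk
    exacts [e0, e1, e2]
  refine freeChart_of_matrixHom P GG hGP (gen 3) L hLinj ?_ ?_ ?_
  · rintro g (rfl | rfl | rfl | rfl | rfl | rfl | rfl | rfl | rfl | rfl | rfl | rfl)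
    · exact ⟨(Finsupp.single 0 2 + Finsupp.single 1 1 : Fin 3 →₀ ℕ), by ext kk; fin_cases kk <;> simp [hLM, Fin.sum_univ_three]⟩
    · exact ⟨(Finsupp.single 0 2 + Finsupp.single 1 1 + Finsupp.single 2 5 : Fin 3 →₀ ℕ), by ext kk; fin_cases kk <;> simp [hLM, Fin.sum_univ_three]⟩
    · exact ⟨(Finsupp.single 0 1 + Finsupp.single 1 3 : Fin 3 →₀ ℕ), by ext kk; fin_cases kk <;> simp [hLM, Fin.sum_univ_three]⟩
    · exact ⟨(Finsupp.single 0 1 + Finsupp.single 1 1 : Fin 3 →₀ ℕ), by ext kk; fin_cases kk <;> simp [hLM, Fin.sum_univ_three]⟩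
    · exact ⟨(Finsupp.single 0 1 + Finsupp.single 1 1 + Finsupp.single 2 2 : Fin 3 →₀ ℕ), by ext kk; fin_cases kk <;> simp [hLM, Fin.sum_univ_three]⟩
    · exact ⟨(Finsupp.single 0 2 + Finsupp.single 1 1 + Finsupp.single 2 1 : Fin 3 →₀ ℕ), by ext kk; fin_cases kk <;> simp [hLM, Fin.sum_univ_three]⟩
    · exact ⟨(Finsupp.single 0 2 + Finsupp.single 1 1 + Finsupp.single 2 4 : Fin 3 →₀ ℕ), by ext kk; fin_cases kk <;> simp [hLM, Fin.sum_univ_three]⟩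
    · exact ⟨(Finsupp.single 0 2 + Finsupp.single 1 1 + Finsupp.single 2 2 : Fin 3 →₀ ℕ), by ext kk; fin_cases kk <;> simp [hLM, Fin.sum_univ_three]⟩
    · exact ⟨(Finsupp.single 0 2 + Finsupp.single 1 1 + Finsupp.single 2 3 : Fin 3 →₀ ℕ), by ext kk; fin_cases kk <;> simp [hLM, Fin.sum_univ_three]⟩
    · exact ⟨(Finsupp.single 0 1 + Finsupp.single 1 2 : Fin 3 →₀ ℕ), by ext kk; fin_cases kk <;> simp [hLM, Fin.sum_univ_three]⟩
    · exact ⟨(Finsupp.single 0 1 + Finsupp.single 1 2 + Finsupp.single 2 1 : Fin 3 →₀ ℕ), by ext kk; fin_cases kk <;> simp [hLM, Fin.sum_univ_three]⟩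
    · exact ⟨(Finsupp.single 0 1 + Finsupp.single 1 1 + Finsupp.single 2 1 : Fin 3 →₀ ℕ), by ext kk; fin_cases kk <;> simp [hLM, Fin.sum_univ_three]⟩
  · rintro g (rfl | rfl | rfl | rfl | rfl | rfl | rfl | rfl | rfl | rfl | rfl | rfl)
    · exact ⟨(Finsupp.single 0 1 : Fin 3 →₀ ℕ), by ext kk; fin_cases kk <;> simp [hLM, Fin.sum_univ_three, hgen3]⟩
    · exact ⟨(Finsupp.single 0 1 + Finsupp.single 2 5 : Fin 3 →₀ ℕ), by ext kk; fin_cases kk <;> simp [hLM, Fin.sum_univ_three, hgen3]⟩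
    · exact ⟨(Finsupp.single 1 2 : Fin 3 →₀ ℕ), by ext kk; fin_cases kk <;> simp [hLM, Fin.sum_univ_three, hgen3]⟩
    · exact ⟨0, by rw [map_zero, hgen3, sub_self]⟩
    · exact ⟨(Finsupp.single 2 2 : Fin 3 →₀ ℕ), by ext kk; fin_cases kk <;> simp [hLM, Fin.sum_univ_three, hgen3]⟩
    · exact ⟨(Finsupp.single 0 1 + Finsupp.single 2 1 : Fin 3 →₀ ℕ), by ext kk; fin_cases kk <;> simp [hLM, Fin.sum_univ_three, hgen3]⟩
    · exact ⟨(Finsupp.single 0 1 + Finsupp.single 2 4 : Fin 3 →₀ ℕ), by ext kk; fin_cases kk <;> simp [hLM, Fin.sum_univ_three, hgen3]⟩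
    · exact ⟨(Finsupp.single 0 1 + Finsupp.single 2 2 : Fin 3 →₀ ℕ), by ext kk; fin_cases kk <;> simp [hLM, Fin.sum_univ_three, hgen3]⟩
    · exact ⟨(Finsupp.single 0 1 + Finsupp.single 2 3 : Fin 3 →₀ ℕ), by ext kk; fin_cases kk <;> simp [hLM, Fin.sum_univ_three, hgen3]⟩
    · exact ⟨(Finsupp.single 1 1 : Fin 3 →₀ ℕ), by ext kk; fin_cases kk <;> simp [hLM, Fin.sum_univ_three, hgen3]⟩
    · exact ⟨(Finsupp.single 1 1 + Finsupp.single 2 1 : Fin 3 →₀ ℕ), by ext kk; fin_cases kk <;> simp [hLM, Fin.sum_univ_three, hgen3]⟩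
    · exact ⟨(Finsupp.single 2 1 : Fin 3 →₀ ℕ), by ext kk; fin_cases kk <;> simp [hLM, Fin.sum_univ_three, hgen3]⟩
  · intro i
    fin_cases i
    · refine ⟨0, 1, ![gen 0], fun l => by fin_cases l; exact hgen0' _, ?_⟩
      rw [Fin.sum_univ_one]
      ext kk; fin_cases kk <;> simp [hLM, Fin.sum_univ_three, hgen3, hgen0]
    · refine ⟨0, 1, ![gen 9], fun l => by fin_cases l; exact hgen0' _, ?_⟩
      rw [Fin.sum_univ_one]
      ext kk; fin_cases kk <;> simp [hLM, Fin.sum_univ_three, hgen3, hgen9]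
    · refine ⟨0, 1, ![gen 11], fun l => by fin_cases l; exact hgen0' _, ?_⟩
      rw [Fin.sum_univ_one]
      ext kk; fin_cases kk <;> simp [hLM, Fin.sum_univ_three, hgen3, hgen11]

set_option maxHeartbeats 400000 in
/-- **The vertex chart of `1/5(1,2,2)` at `(1, 2, 0)`**: free, basis `[[-1, 3, 0], [2, -1, 0], [0, -1, 1]]`. [folklore; cite: CoxLittleSchenck2011, §1.2] -/
theorem chart_4 (P : AddSubmonoid (Fin 3 →₀ ℕ)) (hGP : AddSubmonoid.closure GG = P) (gen : Fin 12 → ↥P)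
    (_hgen0 : ((gen 0 : ↥P) : Fin 3 →₀ ℕ) = (Finsupp.single 2 5 : Fin 3 →₀ ℕ))
    (hgen1 : ((gen 1 : ↥P) : Fin 3 →₀ ℕ) = (Finsupp.single 1 5 : Fin 3 →₀ ℕ))
    (_hgen2 : ((gen 2 : ↥P) : Fin 3 →₀ ℕ) = (Finsupp.single 0 5 : Fin 3 →₀ ℕ))
    (_hgen3 : ((gen 3 : ↥P) : Fin 3 →₀ ℕ) = (Finsupp.single 0 1 + Finsupp.single 2 2 : Fin 3 →₀ ℕ))
    (hgen4 : ((gen 4 : ↥P) : Fin 3 →₀ ℕ) = (Finsupp.single 0 1 + Finsupp.single 1 2 : Fin 3 →₀ ℕ))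
    (_hgen5 : ((gen 5 : ↥P) : Fin 3 →₀ ℕ) = (Finsupp.single 1 1 + Finsupp.single 2 4 : Fin 3 →₀ ℕ))
    (_hgen6 : ((gen 6 : ↥P) : Fin 3 →₀ ℕ) = (Finsupp.single 1 4 + Finsupp.single 2 1 : Fin 3 →₀ ℕ))
    (_hgen7 : ((gen 7 : ↥P) : Fin 3 →₀ ℕ) = (Finsupp.single 1 2 + Finsupp.single 2 3 : Fin 3 →₀ ℕ))
    (_hgen8 : ((gen 8 : ↥P) : Fin 3 →₀ ℕ) = (Finsupp.single 1 3 + Finsupp.single 2 2 : Fin 3 →₀ ℕ))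
    (_hgen9 : ((gen 9 : ↥P) : Fin 3 →₀ ℕ) = (Finsupp.single 0 3 + Finsupp.single 2 1 : Fin 3 →₀ ℕ))
    (hgen10 : ((gen 10 : ↥P) : Fin 3 →₀ ℕ) = (Finsupp.single 0 3 + Finsupp.single 1 1 : Fin 3 →₀ ℕ))
    (hgen11 : ((gen 11 : ↥P) : Fin 3 →₀ ℕ) = (Finsupp.single 0 1 + Finsupp.single 1 1 + Finsupp.single 2 1 : Fin 3 →₀ ℕ))
    (hgen0' : ∀ j, gen j ≠ 0) :
    ∃ (n' : ℕ) (Q : AddSubmonoid (Fin n' →₀ ℕ)) (ι : ↥Q →+ (Fin 3 →₀ ℤ)) (_ : Function.Injective ι)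
      (_ : ∀ e : ↥P, e ≠ 0 → ∃ u : ↥Q, ι u = toZ[3] (e : Fin 3 →₀ ℕ) - toZ[3] ((gen 4 : ↥P) : Fin 3 →₀ ℕ))
      (_ : ∀ p : ↥P, ∃ u : ↥Q, ι u = toZ[3] (p : Fin 3 →₀ ℕ))
      (_ : ∀ u : ↥Q, ∃ (p : ↥P) (r : ℕ) (e : Fin r → ↥P), (∀ i, e i ≠ 0) ∧
        ι u = toZ[3] (p : Fin 3 →₀ ℕ) + ∑ i, (toZ[3] ((e i : ↥P) : Fin 3 →₀ ℕ) - toZ[3] ((gen 4 : ↥P) : Fin 3 →₀ ℕ))),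
      (∀ (κ : Type) [Field κ], IsRegularRing (AddMonoidAlgebra κ ↥Q)) ∨
      ∃ (GQ : Set (Fin n' →₀ ℕ)) (_ : GQ.Finite) (_ : (0 : Fin n' →₀ ℕ) ∉ GQ) (_ : AddSubmonoid.closure GQ = Q),
        (∀ (κ : Type) [Field κ], ∀ u : ↥Q, (u : Fin n' →₀ ℕ) ∈ GQ →
          IsRegularRing (Localization.Away (AddMonoidAlgebra.single u (1 : κ)))) ∧
        (∀ (K : Type) [Field K], Scheme.IsRegular (affineBlowup (Ideal.span {w : ↥(Algebra.adjoin K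
          ((fun d : Fin n' →₀ ℕ => MvPolynomial.monomial d (1 : K)) '' GQ)) |
          ∃ d ∈ GQ, (w : MvPolynomial (Fin n') K) = MvPolynomial.monomial d 1}))) := by
  obtain ⟨L, hLM⟩ := exists_matrixHom (n := 3) (n' := 3) ![![-1, 3, 0], ![2, -1, 0], ![0, -1, 1]]
  have hLinj : Function.Injective L := by
    intro u u' h
    have h0 := DFunLike.congr_fun h 0
    have h1 := DFunLike.congr_fun h 1
    have h2 := DFunLike.congr_fun h 2
    simp [hLM, Fin.sum_univ_three] at h0 h1 h2
    have e0 : u 0 = u' 0 := by omega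
    have e1 : u 1 = u' 1 := by omega
    have e2 : u 2 = u' 2 := by omega
    ext kk
    fin_cases kk
    exacts [e0, e1, e2]
  refine freeChart_of_matrixHom P GG hGP (gen 4) L hLinj ?_ ?_ ?_
  · rintro g (rfl | rfl | rfl | rfl | rfl | rfl | rfl | rfl | rfl | rfl | rfl | rfl)
    · exact ⟨(Finsupp.single 0 2 + Finsupp.single 1 1 + Finsupp.single 2 5 : Fin 3 →₀ ℕ), by ext kk; fin_cases kk <;> simp [hLM, Fin.sum_univ_three]⟩
    · exact ⟨(Finsupp.single 0 2 + Finsupp.single 1 1 : Fin 3 →₀ ℕ), by ext kk; fin_cases kk <;> simp [hLM, Fin.sum_univ_three]⟩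
    · exact ⟨(Finsupp.single 0 1 + Finsupp.single 1 3 : Fin 3 →₀ ℕ), by ext kk; fin_cases kk <;> simp [hLM, Fin.sum_univ_three]⟩
    · exact ⟨(Finsupp.single 0 1 + Finsupp.single 1 1 + Finsupp.single 2 2 : Fin 3 →₀ ℕ), by ext kk; fin_cases kk <;> simp [hLM, Fin.sum_univ_three]⟩
    · exact ⟨(Finsupp.single 0 1 + Finsupp.single 1 1 : Fin 3 →₀ ℕ), by ext kk; fin_cases kk <;> simp [hLM, Fin.sum_univ_three]⟩
    · exact ⟨(Finsupp.single 0 2 + Finsupp.single 1 1 + Finsupp.single 2 4 : Fin 3 →₀ ℕ), by ext kk; fin_cases kk <;> simp [hLM, Fin.sum_univ_three]⟩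
    · exact ⟨(Finsupp.single 0 2 + Finsupp.single 1 1 + Finsupp.single 2 1 : Fin 3 →₀ ℕ), by ext kk; fin_cases kk <;> simp [hLM, Fin.sum_univ_three]⟩
    · exact ⟨(Finsupp.single 0 2 + Finsupp.single 1 1 + Finsupp.single 2 3 : Fin 3 →₀ ℕ), by ext kk; fin_cases kk <;> simp [hLM, Fin.sum_univ_three]⟩
    · exact ⟨(Finsupp.single 0 2 + Finsupp.single 1 1 + Finsupp.single 2 2 : Fin 3 →₀ ℕ), by ext kk; fin_cases kk <;> simp [hLM, Fin.sum_univ_three]⟩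
    · exact ⟨(Finsupp.single 0 1 + Finsupp.single 1 2 + Finsupp.single 2 1 : Fin 3 →₀ ℕ), by ext kk; fin_cases kk <;> simp [hLM, Fin.sum_univ_three]⟩
    · exact ⟨(Finsupp.single 0 1 + Finsupp.single 1 2 : Fin 3 →₀ ℕ), by ext kk; fin_cases kk <;> simp [hLM, Fin.sum_univ_three]⟩
    · exact ⟨(Finsupp.single 0 1 + Finsupp.single 1 1 + Finsupp.single 2 1 : Fin 3 →₀ ℕ), by ext kk; fin_cases kk <;> simp [hLM, Fin.sum_univ_three]⟩
  · rintro g (rfl | rfl | rfl | rfl | rfl | rfl | rfl | rfl | rfl | rfl | rfl | rfl)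
    · exact ⟨(Finsupp.single 0 1 + Finsupp.single 2 5 : Fin 3 →₀ ℕ), by ext kk; fin_cases kk <;> simp [hLM, Fin.sum_univ_three, hgen4]⟩
    · exact ⟨(Finsupp.single 0 1 : Fin 3 →₀ ℕ), by ext kk; fin_cases kk <;> simp [hLM, Fin.sum_univ_three, hgen4]⟩
    · exact ⟨(Finsupp.single 1 2 : Fin 3 →₀ ℕ), by ext kk; fin_cases kk <;> simp [hLM, Fin.sum_univ_three, hgen4]⟩
    · exact ⟨(Finsupp.single 2 2 : Fin 3 →₀ ℕ), by ext kk; fin_cases kk <;> simp [hLM, Fin.sum_univ_three, hgen4]⟩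
    · exact ⟨0, by rw [map_zero, hgen4, sub_self]⟩
    · exact ⟨(Finsupp.single 0 1 + Finsupp.single 2 4 : Fin 3 →₀ ℕ), by ext kk; fin_cases kk <;> simp [hLM, Fin.sum_univ_three, hgen4]⟩
    · exact ⟨(Finsupp.single 0 1 + Finsupp.single 2 1 : Fin 3 →₀ ℕ), by ext kk; fin_cases kk <;> simp [hLM, Fin.sum_univ_three, hgen4]⟩
    · exact ⟨(Finsupp.single 0 1 + Finsupp.single 2 3 : Fin 3 →₀ ℕ), by ext kk; fin_cases kk <;> simp [hLM, Fin.sum_univ_three, hgen4]⟩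
    · exact ⟨(Finsupp.single 0 1 + Finsupp.single 2 2 : Fin 3 →₀ ℕ), by ext kk; fin_cases kk <;> simp [hLM, Fin.sum_univ_three, hgen4]⟩
    · exact ⟨(Finsupp.single 1 1 + Finsupp.single 2 1 : Fin 3 →₀ ℕ), by ext kk; fin_cases kk <;> simp [hLM, Fin.sum_univ_three, hgen4]⟩
    · exact ⟨(Finsupp.single 1 1 : Fin 3 →₀ ℕ), by ext kk; fin_cases kk <;> simp [hLM, Fin.sum_univ_three, hgen4]⟩
    · exact ⟨(Finsupp.single 2 1 : Fin 3 →₀ ℕ), by ext kk; fin_cases kk <;> simp [hLM, Fin.sum_univ_three, hgen4]⟩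
  · intro i
    fin_cases i
    · refine ⟨0, 1, ![gen 1], fun l => by fin_cases l; exact hgen0' _, ?_⟩
      rw [Fin.sum_univ_one]
      ext kk; fin_cases kk <;> simp [hLM, Fin.sum_univ_three, hgen4, hgen1]
    · refine ⟨0, 1, ![gen 10], fun l => by fin_cases l; exact hgen0' _, ?_⟩
      rw [Fin.sum_univ_one]
      ext kk; fin_cases kk <;> simp [hLM, Fin.sum_univ_three, hgen4, hgen10]
    · refine ⟨0, 1, ![gen 11], fun l => by fin_cases l; exact hgen0' _, ?_⟩
      rw [Fin.sum_univ_one]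
      ext kk; fin_cases kk <;> simp [hLM, Fin.sum_univ_three, hgen4, hgen11]

end Summit.ResolutionOfSingularities.ResolutionOfSingularities.Theorems.FRationalResolution.ClassOneFifth122

end
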